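import Literature.MeasureTheory.Group.InvariantQuotientExistence
import Literature.NumberTheory.Automorphic.GLnGelfandKazhdanInvolution
import Literature.NumberTheory.Automorphic.PAdicRepsSupercuspidalProofs
import Literature.NumberTheory.Automorphic.ReductionTheoryGLnConjugation
import Literature.NumberTheory.Automorphic.WhittakerModels
import Literature.NumberTheory.Automorphic.TateLocalZetaShells
import Literature.NumberTheory.Automorphic.GLnIwasawaIntegration
import Literature.MeasureTheory.Group.InvariantQuotientAbelian
import HarnessLib

/-!
# Stub S-ν: an invariant Radon measure on `GL_m(F) ⧸ U_m(F)` (line `Sketch` of the crux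
`IrreducibilityBySelfDuality.ReciprocityUpToIrreducibilityR`, item stmt-Langlands-17925)

For a non-archimedean local field `F` and every `m`, the homogeneous space
`GL_m(F) ⧸ U_m(F)` (`U_m = upperUnitriangular (Fin m) F`) carries, for its Borel σ-algebra, a
`GL_m(F)`-invariant measure which is finite on compact sets and positive on non-empty open sets.
This is Weil's theorem on invariant measures on `G ⧸ H` for the unimodular pair
`GL_m(F) ⊇ U_m(F)` (Deitmar–Echterhoff (2014), Thm. 1.5.3), obtained from the tree's
`Literature.MeasureTheory.Group.quotientMeasure` (`InvariantQuotientExistence`):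

* `GL_m(F)` is locally compact, Hausdorff, second countable (`secondCountableTopology_gl`, from the
  second countability of `F`, the tree's `secondCountableTopology_localField`) and unimodular
  (`isMulRightInvariant_generalLinearGroup`);
* `U_m(F)` is closed (`isClosed_upperUnitriangular`) and unimodular: every `u ∈ U_m(F)` lies in
  the compact subgroup `t GL_m(𝒪) t⁻¹` for a suitable diagonal torus element `t = ϖ^a`
  (`exists_isCompact_subgroup_mem_of_mem_upperUnitriangular`), so the modular character of
  `U_m(F)` is trivial (`modularCharacter_eq_one_of_mem_isCompact`), its Haar measures are right
  invariant (`isMulRightInvariant_of_forall_mem_isCompact_subgroup`) and hence inversion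
  invariant (the tree's `isInvInvariant_of_isMulRightInvariant`);
* a non-zero invariant regular measure on a homogeneous space is positive on non-empty open
  sets (`isOpenPosMeasure_of_smulInvariantMeasure_quotient`).

## References

* A. Deitmar, S. Echterhoff, *Principles of Harmonic Analysis*, 2nd ed. (2014), Thm. 1.5.3
  [DeitmarEchterhoff2014].
* G. B. Folland, *A Course in Abstract Harmonic Analysis* (1995), §2.4 and Thm. 2.49
  [Folland1995].
-/

noncomputable section

-- the Theorems namespace `Summit.Langlands.Langlands.…` repeats `Langlands` (summit = problem name)
set_option linter.dupNamespace false

open scoped MatrixGroups ENNReal NNReal Pointwise Topology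
open MeasureTheory MeasureTheory.Measure Filter Set
open Literature.NumberTheory.Automorphic

namespace Summit.Langlands.Langlands.Theorems.ReciprocityUpToIrreducibilityR

/-! ### Unimodularity from compact subgroups (abstract harmonic analysis) -/

section Unimodular

variable {G : Type*} [Group G] [TopologicalSpace G] [IsTopologicalGroup G] [LocallyCompactSpace G]
  [MeasurableSpace G] [BorelSpace G] [SecondCountableTopology G]

/-- **A group exhausted by compact subgroups is unimodular**: if every `g ∈ G` lies in a compact
subgroup, the modular character is trivial (`modularCharacter_eq_one_of_mem_isCompact`), so every
Haar measure is right invariant (`map (· * g) μ = Δ(g) • μ`). (Folland (1995), §2.4.) [folklore] -/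
theorem isMulRightInvariant_of_forall_mem_isCompact_subgroup
    (h : ∀ g : G, ∃ K : Subgroup G, IsCompact (K : Set G) ∧ g ∈ K)
    (μ : Measure G) [IsHaarMeasure μ] : μ.IsMulRightInvariant := by
  refine ⟨fun g => ?_⟩
  obtain ⟨K, hK, hg⟩ := h g
  have h1 : modularCharacterFun g = 1 := modularCharacter_eq_one_of_mem_isCompact hK hg
  rw [map_right_mul_eq_modularCharacterFun_smul μ g, h1, one_smul]

end Unimodular

/-! ### Positivity on open sets of invariant measures on homogeneous spaces -/

section OpenPos

variable {G : Type*} [Group G] [TopologicalSpace G] [IsTopologicalGroup G] (H : Subgroup G)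
  [MeasurableSpace (G ⧸ H)]

/-- **A non-zero `G`-invariant regular measure on `G ⧸ H` is positive on non-empty open sets**: if
an open `O ∋ x₀` were null, so would be all its translates `g • O`, which cover `G ⧸ H`
(transitivity); every compact set would be null, hence `μ = 0` by inner regularity. [folklore] -/
theorem isOpenPosMeasure_of_smulInvariantMeasure_quotient (μ : Measure (G ⧸ H)) [μ.Regular]
    [SMulInvariantMeasure G (G ⧸ H) μ] (hμ : μ ≠ 0) : μ.IsOpenPosMeasure := by
  refine ⟨fun O hO hne hO0 => ?_⟩
  obtain ⟨x₀, hx₀⟩ := hne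
  obtain ⟨g₀, rfl⟩ := QuotientGroup.mk_surjective x₀
  have huniv : 0 < μ univ := measure_univ_pos.2 hμ
  obtain ⟨K, -, hK, hKpos⟩ := isOpen_univ.exists_lt_isCompact huniv
  -- the translates of `O` cover `K`
  have hcover : K ⊆ ⋃ g : G, g • O := by
    intro y _
    obtain ⟨g, rfl⟩ := QuotientGroup.mk_surjective y
    refine mem_iUnion.2 ⟨g * g₀⁻¹, ?_⟩
    have : (QuotientGroup.mk g : G ⧸ H) = (g * g₀⁻¹) • (QuotientGroup.mk g₀ : G ⧸ H) := by
      rw [MulAction.Quotient.smul_mk, smul_eq_mul, inv_mul_cancel_right]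
    rw [this]
    exact smul_mem_smul_set hx₀
  obtain ⟨T, hT⟩ := hK.elim_finite_subcover (fun g : G => g • O) (fun g => hO.smul g) hcover
  have hle : μ K ≤ ∑ g ∈ T, μ (g • O) := (measure_mono hT).trans (measure_biUnion_finset_le T _)
  have hzero : ∑ g ∈ T, μ (g • O) = 0 := Finset.sum_eq_zero fun g _ => by rw [measure_smul, hO0]
  rw [hzero] at hle
  exact (lt_irrefl _) (hKpos.trans_le hle)

end OpenPos

/-! ### `GL_m(F)` is second countable; `U_m(F)` is unimodular -/

section LocalField

variable (F : Type*) [Field F] [ValuativeRel F] [TopologicalSpace F] [IsNonarchimedeanLocalField F]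

/-- **`GL_m(F)` is second countable** (a subspace of `M_m(F) × M_m(F)ᵐᵒᵖ` under `g ↦ (g, g⁻¹)`,
Mathlib `Units.isEmbedding_embedProduct`). [folklore] -/
theorem secondCountableTopology_gl (m : ℕ) : SecondCountableTopology (GL (Fin m) F) := by
  haveI := secondCountableTopology_localField F
  haveI : SecondCountableTopology (Matrix (Fin m) (Fin m) F) :=
    inferInstanceAs (SecondCountableTopology (Fin m → Fin m → F))
  haveI : SecondCountableTopology (Matrix (Fin m) (Fin m) F)ᵐᵒᵖ :=
    MulOpposite.opHomeomorph.symm.secondCountableTopology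
  exact Units.isEmbedding_embedProduct.secondCountableTopology

variable {F}

/-- **Every upper unitriangular matrix lies in a compact subgroup of `GL_m(F)`**: for `u ∈ U_m(F)`
and `t = ϖ^a`, `a_i = M i` with `M` large, the conjugate `t⁻¹ u t` has entries
`ϖ^{M(j-i)} u_{ij} ∈ 𝒪` (`i < j`), `1` (`i = j`), `0` (`i > j`) and determinant `1`, so lies in
`GL_m(𝒪)`; hence `u ∈ t GL_m(𝒪) t⁻¹`, a compact subgroup. (The standard fact that `U_m(F)` is the
union of its compact open subgroups; Bernstein–Zelevinsky (1976), §3.) [folklore] -/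
theorem exists_isCompact_subgroup_mem_of_mem_upperUnitriangular {m : ℕ} {u : GL (Fin m) F}
    (hu : u ∈ upperUnitriangular (Fin m) F) :
    ∃ K : Subgroup (GL (Fin m) F), IsCompact (K : Set (GL (Fin m) F)) ∧ u ∈ K := by
  classical
  obtain ⟨ϖ, hϖ⟩ := exists_isUniformizingElement (F := F)
  obtain ⟨hut, hud⟩ := (mem_upperUnitriangular_iff u).1 hu
  -- a uniform exponent `M` with `ϖ^M u_{ij} ∈ 𝒪` for all `i, j`
  choose N hN using fun p : Fin m × Fin m =>
    exists_pow_mul_mem hϖ ((u : Matrix (Fin m) (Fin m) F) p.1 p.2)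
  set M : ℕ := ∑ p, N p
  have hNM : ∀ p, N p ≤ M := fun p =>
    Finset.single_le_sum (fun p _ => Nat.zero_le (N p)) (Finset.mem_univ p)
  set a : Fin m → ℤ := fun i => (M : ℤ) * ((i : ℕ) : ℤ) with ha
  set t : GL (Fin m) F := zpowDiagGL hϖ.ne_zero a with ht
  -- `t⁻¹ u t ∈ GL_m(𝒪)`
  have hmem : t⁻¹ * u * t ∈ glInt m F := by
    refine mem_glInt_of_isIntegralMatrix (fun i j => ?_) ?_
    · rw [ht, coe_zpowDiagGL_inv_mul_mul_apply]
      rcases lt_trichotomy i j with hij | rfl | hji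
      · -- above the diagonal: exponent `M (j - i) = M d + M` with `j = i + d + 1`
        obtain ⟨d, hd⟩ : ∃ d : ℕ, (j : ℕ) = (i : ℕ) + d + 1 := ⟨(j : ℕ) - (i : ℕ) - 1, by
          have : (i : ℕ) < (j : ℕ) := hij
          omega⟩
        have hexp : a j - a i = ((M * d + M : ℕ) : ℤ) := by
          simp only [ha, hd]
          push_cast
          ring
        rw [hexp, zpow_natCast, pow_add, mul_assoc]
        exact Subring.mul_mem _ (Subring.pow_mem _ hϖ.mem _) (hN (i, j) M (hNM (i, j)))
      · -- on the diagonal: `ϖ^0 · 1`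
        rw [sub_self, zpow_zero, one_mul, hud]
        exact Subring.one_mem _
      · -- below the diagonal: `0`
        rw [hut hji, mul_zero]
        exact Subring.zero_mem _
    · rw [← Matrix.GeneralLinearGroup.val_det_apply, map_mul, map_mul,
        det_eq_one_of_mem_upperUnitriangular hu, mul_one, map_inv, inv_mul_cancel, Units.val_one,
        map_one]
  -- the compact subgroup `t GL_m(𝒪) t⁻¹`
  have hcont : Continuous fun k : GL (Fin m) F => t * k * t⁻¹ := by fun_prop
  have hcoe : (⇑(MulAut.conj t).toMonoidHom : GL (Fin m) F → GL (Fin m) F) =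
      fun k => t * k * t⁻¹ := funext fun k => by
    rw [MulEquiv.coe_toMonoidHom, MulAut.conj_apply]
  refine ⟨(glInt m F).map (MulAut.conj t).toMonoidHom, ?_, ?_⟩
  · rw [Subgroup.coe_map, hcoe]
    exact (isCompact_glInt m F).image hcont
  · refine Subgroup.mem_map.2 ⟨t⁻¹ * u * t, hmem, ?_⟩
    rw [MulEquiv.coe_toMonoidHom, MulAut.conj_apply]
    group

/-- **`U_m(F)` is unimodular**: every Haar measure of the closed subgroup
`U_m(F) ≤ GL_m(F)` (subspace topology) is right invariant — each element lies in a compact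
subgroup (`exists_isCompact_subgroup_mem_of_mem_upperUnitriangular`, pulled back along the closed
embedding `U_m(F) ↪ GL_m(F)`). (Bernstein–Zelevinsky (1976), §3; Folland (1995), §2.4.) [folklore] -/
theorem isMulRightInvariant_of_isHaarMeasure_upperUnitriangular {m : ℕ}
    [T2Space (GL (Fin m) F)] [LocallyCompactSpace (GL (Fin m) F)]
    [SecondCountableTopology (GL (Fin m) F)]
    [MeasurableSpace ↥(upperUnitriangular (Fin m) F)] [BorelSpace ↥(upperUnitriangular (Fin m) F)]
    (ρ : Measure ↥(upperUnitriangular (Fin m) F)) [IsHaarMeasure ρ] : ρ.IsMulRightInvariant := by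
  have hU : IsClosed (upperUnitriangular (Fin m) F : Set (GL (Fin m) F)) := by
    haveI : T2Space F :=
      (Literature.NumberTheory.GaloisRepresentations.IsNonarchimedeanLocalField.isLocalField F).toT2Space
    exact isClosed_upperUnitriangular
  haveI : LocallyCompactSpace ↥(upperUnitriangular (Fin m) F) :=
    hU.isClosedEmbedding_subtypeVal.locallyCompactSpace
  haveI : SecondCountableTopology ↥(upperUnitriangular (Fin m) F) :=
    TopologicalSpace.Subtype.secondCountableTopology _
  refine isMulRightInvariant_of_forall_mem_isCompact_subgroup (fun g => ?_) ρ
  obtain ⟨K, hK, hgK⟩ := exists_isCompact_subgroup_mem_of_mem_upperUnitriangular g.2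
  refine ⟨K.subgroupOf (upperUnitriangular (Fin m) F), ?_, Subgroup.mem_subgroupOf.2 hgK⟩
  rw [Subgroup.coe_subgroupOf, Subgroup.coe_subtype]
  exact hU.isClosedEmbedding_subtypeVal.isCompact_preimage hK

end LocalField

/-! ### The stub -/

/-- **Stub S-ν (invariant measures on `GL_m(F) ⧸ U_m`)**: for a non-archimedean local field `F`
and every `m`, the coset space `GL_m(F) ⧸ U_m(F)` carries, for its Borel σ-algebra, a
`GL_m(F)`-invariant measure, finite on compact sets and positive on non-empty open sets — the
invariant Radon measure of Weil's theorem for the unimodular pair `GL_m(F) ⊇ U_m(F)`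
(`Literature.MeasureTheory.Group.quotientMeasure` for a Haar measure of `GL_m(F)`, right invariant
by `isMulRightInvariant_generalLinearGroup`, and a Haar measure of `U_m(F)`, inversion invariant by
`isMulRightInvariant_of_isHaarMeasure_upperUnitriangular`). [cite: DeitmarEchterhoff2014, Thm. 1.5.3] -/
theorem stub_exists_invariantMeasure_glQuotient : ∀ (F : Type) [Field F] [ValuativeRel F] [TopologicalSpace F] [IsNonarchimedeanLocalField F] (m : ℕ), ∃ (_ : MeasurableSpace (GL (Fin m) F ⧸ upperUnitriangular (Fin m) F)) (_ : BorelSpace (GL (Fin m) F ⧸ upperUnitriangular (Fin m) F)) (ν : Measure (GL (Fin m) F ⧸ upperUnitriangular (Fin m) F)), SMulInvariantMeasure (GL (Fin m) F) (GL (Fin m) F ⧸ upperUnitriangular (Fin m) F) ν ∧ IsFiniteMeasureOnCompacts ν ∧ ν.IsOpenPosMeasure := by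
  intro F _ _ _ _ m
  haveI : T2Space (GL (Fin m) F) := t2Space_generalLinearGroup F m
  haveI : LocallyCompactSpace (GL (Fin m) F) := locallyCompactSpace_generalLinearGroup F m
  haveI : SecondCountableTopology (GL (Fin m) F) := secondCountableTopology_gl F m
  borelize (GL (Fin m) F)
  have hU : IsClosed (upperUnitriangular (Fin m) F : Set (GL (Fin m) F)) := by
    haveI : T2Space F :=
      (Literature.NumberTheory.GaloisRepresentations.IsNonarchimedeanLocalField.isLocalField F).toT2Space
    exact isClosed_upperUnitriangular
  letI : MeasurableSpace ↥(upperUnitriangular (Fin m) F) := borel _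
  haveI : BorelSpace ↥(upperUnitriangular (Fin m) F) := ⟨rfl⟩
  haveI : LocallyCompactSpace ↥(upperUnitriangular (Fin m) F) :=
    hU.isClosedEmbedding_subtypeVal.locallyCompactSpace
  haveI : SecondCountableTopology ↥(upperUnitriangular (Fin m) F) :=
    TopologicalSpace.Subtype.secondCountableTopology _
  letI : MeasurableSpace (GL (Fin m) F ⧸ upperUnitriangular (Fin m) F) := borel _
  haveI : BorelSpace (GL (Fin m) F ⧸ upperUnitriangular (Fin m) F) := ⟨rfl⟩
  set ρ : Measure ↥(upperUnitriangular (Fin m) F) := haar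
  haveI : ρ.IsMulRightInvariant := isMulRightInvariant_of_isHaarMeasure_upperUnitriangular ρ
  haveI : ρ.IsInvInvariant := isInvInvariant_of_isMulRightInvariant ρ
  set μ : Measure (GL (Fin m) F) := haar
  haveI : μ.IsMulRightInvariant := isMulRightInvariant_generalLinearGroup μ
  set ν := Literature.MeasureTheory.Group.quotientMeasure (upperUnitriangular (Fin m) F) ρ hU μ
  haveI : SMulInvariantMeasure (GL (Fin m) F) (GL (Fin m) F ⧸ upperUnitriangular (Fin m) F) ν :=
    Literature.MeasureTheory.Group.smulInvariantMeasure_quotientMeasure _ ρ hU μ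
  haveI : ν.Regular := Literature.MeasureTheory.Group.regular_quotientMeasure _ ρ hU μ
  exact ⟨_, ⟨rfl⟩, ν, inferInstance, inferInstance,
    isOpenPosMeasure_of_smulInvariantMeasure_quotient _ ν
      (Literature.MeasureTheory.Group.quotientMeasure_ne_zero _ ρ hU μ)⟩

end Summit.Langlands.Langlands.Theorems.ReciprocityUpToIrreducibilityR
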